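import Literature.AnabelianGeometry.EtaleTheta.XuuCocycleOfKummer
import Literature.AnabelianGeometry.EtaleTheta.IsThetaKummer
import Literature.AnabelianGeometry.EtaleTheta.ConstantMultipleRigidityEquivarianceProofs
import HarnessLib

/-!
# [EtTh] Prop. 2.2 (ii) / Def. 2.7 in the §1 model: the choice `X̲̲` from the two CLASS-LEVEL clauses of
# Prop. 1.4 (ii) — the sign clause `(P14ii-cl)` and the `l·Z`-translate clause modulo `l`

Mochizuki, *The étale theta function and its Frobenioid-theoretic manifestations*, Publ. RIMS **45**
(2009): Prop. 1.4 (ii) (PRIMS PDF p. 22: "`Θ̈(−Ü) = −Θ̈(Ü)`", "`Θ̈(q_X^{a/2}Ü) = (−1)^a q_X^{−a²/2} Ü^{−2a} Θ̈(Ü)`"),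
Prop. 1.5 (ii) (p. 23: "`F̈² = H¹(G_K̈, Δ_Θ)`"), Def. 2.7 (p. 41: "`Π^tp_X̲/Π^tp_Ÿ ≅ (l·Z) × μ₂`", "a choice of
`η̈^Θ` up to an `(O_K^×)^l`-multiple") [cite: MochizukiEtTh2009, Def 2.7 p.41].

Cell abc-iut, layer L2, item N3 (seat abc-iut-L2-t7). PROOF-ONLY (0 definitions). The landed chain
`XuuCocycleOfInvariance.lean` (`doubleUnderlineOfInvariance`: `X̲̲` from the invariance of `η̈^Θ` modulo
`l`-th powers under `Π^tp_X̲`, reduced to two generators) is fed here by the two CLASS-LEVEL clauses of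
Prop. 1.4 (ii), with no reference to a group of functions:

* `(P14ii-cl)` — "every `ε ∈ Π^tp_Y` moves `η̈^Θ` by a class of square `1`" (the shape PROVED from the
  named fact `Prop15iii` + `K = K̈` by seat abc-iut-L2-t1, `Sec1DeckSign.exists_sq_eq_one_and_conj_eq`;
  here a hypothesis `hμ₂`, so that this file does not depend on that module);
* `(l·Z mod l)` — "some lift `t` of `l ∈ Z` moves `η̈^Θ` by an `l`-th power" (Prop. 1.4 (ii) at `a = l`:
  `t·η̈^Θ = η̈^Θ − 2l·log(Ü) − l²·log(q̈) + log((−1)^l)`, every term an `l`-th multiple; NOT a consequence of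
  Prop. 1.5 (iii), which fixes the `Z`-action only "`+ log(O^×_K̈)`");

and, for the Kummer-function presentation, the `l·Z` clause is supplied from `t•Θ̈ = g^l·Θ̈`
(`XuuCocycleOfKummer`) for EVERY member of the orbit `O^×_K̈ · κ(Θ̈)` — the unit factor is inert under
`Π^tp_X` by Prop. 1.5 (ii) (`F̈² = log(K̈^×)`, acted on through `G_K̈`: seat abc-iut-w5-d234's
`conj_inflTheta_kumYdd_eq_self_of_aug_mem_GKdd`), so that `η̈^Θ = κ(Θ̈)` weakens to seat abc-iut-L2-t12's
ruled relation `IsThetaKummer E T`. Headlines: `nonempty_doubleUnderline_of_classLevel`,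
`nonempty_doubleUnderline_of_isThetaKummer`. No new `Prop` fact; nothing of [EtTh] is asserted;
typed ≠ endorsed; no side is taken on any disputed claim.
-/

noncomputable section

namespace Literature.AnabelianGeometry.EtaleTheta

open Literature.AnabelianGeometry.SemiGraphs
open scoped IsMulCommutative

namespace ThetaSetting

variable {p : ℕ} [Fact p.Prime] {D : ThetaSetting p}

namespace EtaleThetaData

variable {E : D.EtaleThetaData}

/-! ### The sign clause `(P14ii-cl)` as a generator statement -/

/-- **`(P14ii-cl)` ⇒ the `μ₂`-generator**: if every `ε ∈ Π^tp_Y` moves `x` by a class of square `1`, then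
every `ε ∈ Π^tp_Y` stabilises `x` modulo `n`-th powers for `n` ODD (`κ₁ = κ₁^n`).
[cite: MochizukiEtTh2009, Prop 1.4 (ii) p.22] -/
theorem mem_invModPowStabilizer_of_signClause [D.GtpYdd.Normal] {x : D.H1 D.GtpYdd}
    (hμ₂ : ∀ ε ∈ D.GtpY, ∃ κ₁ : D.H1 D.GtpYdd, κ₁ ^ 2 = 1 ∧
      ContH1.conj D.toTheta D.DeltaTheta ε x = x * κ₁)
    {n : ℕ} (hn : Odd n) {ε : D.PiTemp} (hε : ε ∈ D.GtpY) : ε ∈ invModPowStabilizer x n := by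
  obtain ⟨κ, hκ, h⟩ := hμ₂ ε hε
  exact mem_invModPowStabilizer_of_sq_eq_one x hn hκ h

/-- **`X̲̲` exists from the §1 inputs and the two class-level clauses of Prop. 1.4 (ii)**: `Compat`,
`K = K̈`, `Prop15iii` (normalisation over `Δ_Θ`), `CyclotomeMod 1 l`, `l` odd, the sign clause `hμ₂`
(`(P14ii-cl)`: every `ε ∈ Π^tp_Y` moves `η̈^Θ` by a class of square `1`) and the translate clause `ht`
(some `t` with `toZ t = l` moves `η̈^Θ` by an `l`-th power). [cite: MochizukiEtTh2009, Def 2.7 p.41] -/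
theorem nonempty_doubleUnderline_of_classLevel (hC : D.Compat) (hS : D.Sec2Hyps) [D.GtpYdd.Normal]
    (h15 : Prop15iii E hC) {l : ℕ+} (μ : D.CyclotomeMod 1 l) (hl : Odd (l : ℕ))
    (hμ₂ : ∀ ε ∈ D.GtpY, ∃ κ₁ : D.H1 D.GtpYdd, κ₁ ^ 2 = 1 ∧
      ContH1.conj D.toTheta D.DeltaTheta ε E.etaDd = E.etaDd * κ₁)
    {t : D.PiTemp} (htZ : D.toZ t = Multiplicative.ofAdd ((l : ℕ) : ℤ))
    (ht : ∃ κ : D.H1 D.GtpYdd, ContH1.conj D.toTheta D.DeltaTheta t E.etaDd = E.etaDd * κ ^ (l : ℕ)) :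
    Nonempty (E.DoubleUnderline l) := by
  obtain ⟨t₁, ht₁, ht₁N⟩ := D.exists_mem_GtpY_not_mem_GtpYdd hS
  have h₁ : t₁ ∈ invModPowStabilizer E.etaDd (l : ℕ) := mem_invModPowStabilizer_of_signClause hμ₂ hl ht₁
  exact nonempty_doubleUnderline_of_invariance hC hS h15 μ hl
    (invariant_modPow_of_generators hS E.etaDd (l : ℕ) hl.pos.ne' ht₁ ht₁N
      ((mem_invModPowStabilizer_iff E.etaDd (l : ℕ) t₁).mp h₁) (mem_GtpXu_of_toZ_eq htZ)
      (toZDivL_eq_of_toZ_eq hl.pos.ne' htZ) ht)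

/-! ### The unit factor of a theta class is inert under `Π^tp_X` (under `K = K̈`) -/

/-- **The Kummer classes of units `log(O^×_K̈) ⊆ H¹(Π^tp_Ÿ, Δ_Θ)` are fixed by every `σ ∈ Π^tp_X`** under
`K = K̈`: by seat abc-iut-w5-d234's `conj_inflTheta_kumYdd_eq_self_of_aug_mem_GKdd` (Prop. 1.5 (ii):
`F̈² = log(K̈^×)`, on which `Π^tp_X` acts through `G_K̈`; here `aug(σ) ∈ G_K = G_K̈`).
[cite: MochizukiEtTh2009, Prop 1.5 (ii) p.23] -/
theorem conj_eq_self_of_mem_kumUnitsYdd (hC : D.Compat) (hS : D.Sec2Hyps)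
    (h15ii : Prop15ii E.toKummerData hC) {k : D.H1 D.GtpYdd} (hk : k ∈ E.kumUnitsYdd)
    (σ : D.PiTemp) :
    haveI := hC.GtpYdd_normal
    ContH1.conj D.toTheta D.DeltaTheta σ k = k := by
  obtain ⟨c, hc, rfl⟩ := hk
  obtain ⟨u, -, rfl⟩ := hc
  have hσ : D.aug.toMonoidHom σ ∈ D.GKdd := by
    have e : D.GKdd = D.GK := hS.GKdd_eq
    rw [e]
    exact D.aug_mem_GK σ
  exact E.toKummerData.conj_inflTheta_kumYdd_eq_self_of_aug_mem_GKdd hC h15ii hσ u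

variable (T : D.ThetaKummerInput)

/-- **The `l·Z`-generator for every class of the orbit `O^×_K̈ · κ(Θ̈)`**: if `t` pulls `Θ̈` back to
`g^n · Θ̈` (Prop. 1.4 (ii) at the Kummer-function level) then `t` stabilises `k · κ(Θ̈)` modulo `n`-th
powers for every unit Kummer class `k ∈ log(O^×_K̈)` — the unit factor is `t`-invariant
(`conj_eq_self_of_mem_kumUnitsYdd`). [cite: MochizukiEtTh2009, Prop 1.4 (ii) p.22] -/
theorem mem_invModPowStabilizer_mul_kummerTheta (hC : D.Compat) (hS : D.Sec2Hyps) [D.GtpYdd.Normal]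
    (h15ii : Prop15ii E.toKummerData hC) {k : D.H1 D.GtpYdd} (hk : k ∈ E.kumUnitsYdd)
    {g : T.Fn} (hg : g ∈ MulAction.fixedPoints D.GtpYdd T.Fn) (x : RootSystem g) (n : ℕ)
    {t : D.PiTemp} (ht : t • T.theta = g ^ n * T.theta) :
    t ∈ invModPowStabilizer (k * T.kummerTheta) n :=
  ⟨T.coeff.kummerContClass D.GtpYdd x hg (fun _ => T.isOpen_stabilizer _), by
    rw [map_mul, conj_eq_self_of_mem_kumUnitsYdd hC hS h15ii hk t,
      T.conj_kummerTheta_of_smul_eq_pow_mul hg x n ht]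
    simp only [mul_assoc, mul_comm]⟩

/-- **The translate clause for `η̈^Θ ∈ O^×_K̈ · κ(Θ̈)`**: under `IsThetaKummer E T` and Prop. 1.5 (ii), a
pull-back identity `t•Θ̈ = g^n·Θ̈` gives `t·η̈^Θ = η̈^Θ·κ(g)^n` — the unit factor drops out.
[cite: MochizukiEtTh2009, Prop 1.4 (ii) p.22] -/
theorem exists_conj_etaDd_eq_mul_pow_of_isThetaKummer (hC : D.Compat) (hS : D.Sec2Hyps)
    [D.GtpYdd.Normal] (h15ii : Prop15ii E.toKummerData hC) (hηT : E.IsThetaKummer T)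
    {g : T.Fn} (hg : g ∈ MulAction.fixedPoints D.GtpYdd T.Fn) (x : RootSystem g) (n : ℕ)
    {t : D.PiTemp} (ht : t • T.theta = g ^ n * T.theta) :
    ∃ κ : D.H1 D.GtpYdd, ContH1.conj D.toTheta D.DeltaTheta t E.etaDd = E.etaDd * κ ^ n := by
  obtain ⟨k, hk, hη⟩ := hηT
  rw [hη]
  exact (mem_invModPowStabilizer_iff _ n t).mp
    (mem_invModPowStabilizer_mul_kummerTheta T hC hS h15ii hk hg x n ht)

/-- **`X̲̲` exists for `η̈^Θ ∈ O^×_K̈ · κ(Θ̈)`** (`IsThetaKummer E T`, seat abc-iut-L2-t12's ruled relation,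
instead of `η̈^Θ = κ(Θ̈)`): from `Compat`, `K = K̈`, `Prop15iii`, `Prop15ii` (inertness of the unit factor),
`CyclotomeMod 1 l`, `l` odd, the sign clause `hμ₂` (`(P14ii-cl)`), and Prop. 1.4 (ii) at `a = l` on the
function `Θ̈`: `t•Θ̈ = g^l·Θ̈` for one `t` with `toZ t = l` and one `g ∈ Fn^{Π^tp_Ÿ}` with compatible roots
(print: `g = −q̈^{−l}·Ü^{∓2}`). [cite: MochizukiEtTh2009, Def 2.7 p.41] -/
theorem nonempty_doubleUnderline_of_isThetaKummer (hC : D.Compat) (hS : D.Sec2Hyps)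
    (h15 : Prop15iii E hC) (h15ii : Prop15ii E.toKummerData hC) {l : ℕ+} (μ : D.CyclotomeMod 1 l)
    (hl : Odd (l : ℕ)) (hηT : E.IsThetaKummer T)
    (hμ₂ : ∀ ε ∈ D.GtpY, ∃ κ₁ : D.H1 D.GtpYdd, κ₁ ^ 2 = 1 ∧
      haveI := hC.GtpYdd_normal
      ContH1.conj D.toTheta D.DeltaTheta ε E.etaDd = E.etaDd * κ₁)
    {g : T.Fn} (hg : g ∈ MulAction.fixedPoints D.GtpYdd T.Fn) (x : RootSystem g)
    {t : D.PiTemp} (htZ : D.toZ t = Multiplicative.ofAdd ((l : ℕ) : ℤ))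
    (htrans : t • T.theta = g ^ (l : ℕ) * T.theta) :
    Nonempty (E.DoubleUnderline l) := by
  haveI := hC.GtpYdd_normal
  exact nonempty_doubleUnderline_of_classLevel hC hS h15 μ hl hμ₂ htZ
    (exists_conj_etaDd_eq_mul_pow_of_isThetaKummer T hC hS h15ii hηT hg x (l : ℕ) htrans)

end EtaleThetaData

end ThetaSetting

end Literature.AnabelianGeometry.EtaleTheta

end
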